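import Literature.Analysis.FluidPDE.GeneralizedEnergyInequality
import Literature.Analysis.FluidPDE.LerayHopfGeneralizedEnergyIneq
import Literature.Analysis.FluidPDE.StatisticalSolutionEnergyEq
import HarnessLib

/-!
# The generalized energy inequality of a Leray–Hopf solution with steady force

Analysis/FluidPDE support file for the discharge of
`Literature.Analysis.FluidPDE.timeAverage_isStationary` (Foias–Manley–Rosa–Temam 2001, Ch. IV
Thm. 3.1, property (1.31): the energy inequality of a stationary statistical solution on energy
shells). The trajectory-level input of the printed proof (App. B.2, (B.33)–(B.36), PDF
pp. 259–261) is

  `ρ(|u(T)|²) - ρ(|u₀|²) ≤ 2 ∫₀ᵀ [(f, u(t)) - ν‖u(t)‖²] ρ'(|u(t)|²) dt` for `ρ' = ψ ≥ 0`,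

and its consequence (B.36): `liminf T⁻¹ ∫₀ᵀ 2[(f,u) - ν‖u‖²] ρ'(|u|²) ≥ 0`. Here they are derived
for the tree's global Leray–Hopf solutions on `T^d` (steady force `F ∈ L²`, viscosity `ν > 0`,
slices lifted to `H`) from the energy inequalities from `0` and from a.e. `s > 0` alone, through
the abstract envelope argument `Literature.Analysis.FluidPDE.intervalIntegral_le_integral_mul_of_restart`
(`GeneralizedEnergyInequality`):

* (the integrability of `t ↦ (F, u(t))` on `(0, T]` is
  `IsGlobalLerayHopf.integrableOn_integral_inner_force` of the sibling file
  `LerayHopfGeneralizedEnergyIneq`, which derives the same generalized energy inequality for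
  bounded *Lipschitz* `ρ'` by Steklov averaging; the present file obtains it for *continuous*
  `ρ'` through the envelope/partition route of `GeneralizedEnergyInequality`);
* `IsGlobalLerayHopf.energy_sub_le_integral` — the restarted inequality
  `|u(t)|² - |u(s)|² ≤ ∫ₛᵗ 2[(F,u) - ν‖∇u‖²]` from good `s` (and from `s = 0` with `|u₀|²`);
* `IsGlobalLerayHopf.intervalIntegral_psi_le` — **the generalized energy inequality**
  `∫_{|u₀|²}^{|u(T)|²} ψ ≤ ∫₀ᵀ ψ(|u(t)|²) 2[(F,u(t)) - ν‖∇u(t)‖²] dt` for continuous `0 ≤ ψ ≤ M`;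
* `IsGlobalLerayHopf.timeMean_psi_dissipation_le` — **(B.36) in Cesàro form**:
  `T⁻¹ ∫₀ᵀ ψ(|u|²) [ν‖∇u‖² - (F,u)] ≤ (M · ½|u₀|²) T⁻¹`.

## References

* C. Foias, O. Manley, R. Rosa, R. Temam, *Navier–Stokes Equations and Turbulence*, Cambridge
  Univ. Press (2001), Ch. II (7.5); App. IV.B.2, (B.33)–(B.36) (PDF pp. 259–261). [FMRT2001]
-/

noncomputable section

open MeasureTheory Set Filter Topology UnitAddTorus intervalIntegral
open scoped InnerProductSpace RealInnerProductSpace ENNReal NNReal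

namespace Literature.Analysis.FluidPDE.Torus

variable {d : Type*} [Fintype d] [DecidableEq d]

variable {ν : ℝ} {F u₀ : (UnitAddTorus d → EuclideanSpace ℝ d)} {u : ℝ → (UnitAddTorus d → EuclideanSpace ℝ d)} {U : ℝ → FunctionSpaces.Torus.energySpace d}

/-! ### The restarted energy inequality and its generalized form -/

/-- **The restarted energy inequality in integral form**: if the Leray–Hopf energy inequality
holds between `s ≥ 0` and `t ≥ s` with initial energy `Es` (`= ½|u(s)|²` for good `s`, `= ½|u₀|²`
for `s = 0`), then `|u(t)|² - 2Es ≤ ∫ₛᵗ 2[(F, u) - ν‖∇u‖²]` (the dissipation `∫ₛᵗ ‖∇u‖²` as a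
genuine Bochner integral of the a.e.-finite slice enstrophy). [cite: FMRT2001, Ch. II (7.5)] -/
theorem IsGlobalLerayHopf.energy_sub_le_integral (hν : 0 < ν) (hF : MemLp F 2 volume)
    (hu : IsGlobalLerayHopf ν (fun _ => F) u₀ u)
    (hU : ∀ t, 0 ≤ t → ((U t : (Lp (EuclideanSpace ℝ d) 2 (volume : Measure (UnitAddTorus d)))) : (UnitAddTorus d → EuclideanSpace ℝ d)) =ᵐ[volume] u t) {s t Es : ℝ} (hs : 0 ≤ s)
    (hst : s ≤ t)
    (hE : FunctionSpaces.Torus.kineticEnergy (u t) +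
        ν * (∫⁻ τ in Ioo s t, FunctionSpaces.Torus.eGradNormSq (u τ)).toReal ≤
      Es + ∫ τ in s..t, ∫ x, ⟪F x, u τ x⟫) :
    (∫ x, ‖u t x‖ ^ 2) - 2 * Es ≤
      ∫ τ in s..t, 2 * ((∫ x, ⟪F x, u τ x⟫) - ν * (FunctionSpaces.Torus.eGradNormSq (u τ)).toReal) := by
  rcases eq_or_lt_of_le (hs.trans hst) with ht0 | ht0
  · -- `s = t = 0`
    have hs0 : s = 0 := le_antisymm (hst.trans_eq ht0.symm) hs
    subst hs0
    rw [← ht0] at hE ⊢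
    simp only [integral_same, add_zero, Measure.restrict_empty, Ioo_self, lintegral_zero_measure,
      ENNReal.toReal_zero, mul_zero] at hE ⊢
    have hkin : FunctionSpaces.Torus.kineticEnergy (u 0) = 2⁻¹ * ∫ x, ‖u 0 x‖ ^ 2 := rfl
    rw [hkin] at hE
    linarith
  -- `t > 0`: all terms are integrable on `(s, t]`
  have hφ : IntegrableOn (fun τ => ∫ x, ⟪F x, u τ x⟫) (Ioc s t) :=
    (hu.integrableOn_integral_inner_force hν hF hU ht0).mono_set (Ioc_subset_Ioc_left hs)
  have hg := hu.integrableOn_toReal_eGradNormSq ht0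
  have hgst : IntegrableOn (fun τ => (FunctionSpaces.Torus.eGradNormSq (u τ)).toReal) (Ioc s t) :=
    hg.1.mono_set (Ioc_subset_Ioc_left hs)
  have hD : ∫ τ in s..t, (FunctionSpaces.Torus.eGradNormSq (u τ)).toReal =
      (∫⁻ τ in Ioo s t, FunctionSpaces.Torus.eGradNormSq (u τ)).toReal := by
    have hLH := hu t ht0
    have hsub : Ioo s t ⊆ Ioo 0 t := Ioo_subset_Ioo hs le_rfl
    have hmeas : AEMeasurable (fun τ => FunctionSpaces.Torus.eGradNormSq (u τ)) (volume.restrict (Ioo s t)) :=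
      hLH.aemeasurable_eGradNormSq.mono_measure (Measure.restrict_mono hsub le_rfl)
    have hfin : ∫⁻ τ in Ioo s t, FunctionSpaces.Torus.eGradNormSq (u τ) < ⊤ :=
      (lintegral_mono_set hsub).trans_lt hLH.lintegral_eGradNormSq_lt_top
    rw [integral_of_le hst, setIntegral_congr_set (Ioo_ae_eq_Ioc (μ := volume) (a := s) (b := t)).symm,
      integral_toReal hmeas (ae_lt_top' hmeas hfin.ne)]
  rw [intervalIntegral.integral_const_mul, integral_of_le hst,
    integral_sub hφ (hgst.const_mul ν), MeasureTheory.integral_const_mul, ← integral_of_le hst,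
    ← integral_of_le hst, hD]
  have hkin : FunctionSpaces.Torus.kineticEnergy (u t) = 2⁻¹ * ∫ x, ‖u t x‖ ^ 2 := rfl
  rw [hkin] at hE
  linarith

/-- **The generalized energy inequality of a Leray–Hopf solution** (FMRT 2001, App. B.2, display
after (B.35), p. 261): for a global Leray–Hopf solution on `T^d` with viscosity `ν > 0`, steady
force `F ∈ L²` and slices lifted to `H`, and every continuous `ψ` with `0 ≤ ψ ≤ M`,
`∫_{|u₀|²}^{|u(T)|²} ψ ≤ ∫₀ᵀ ψ(|u(t)|²) · 2[(F, u(t)) - ν‖∇u(t)‖²] dt` (`T > 0`), obtained from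
the energy inequalities from `0` and from a.e. `s` through
`Literature.Analysis.FluidPDE.intervalIntegral_le_integral_mul_of_restart`. [cite: FMRT2001, App. B.2 (B.33)–(B.35)] -/
theorem IsGlobalLerayHopf.intervalIntegral_psi_le (hν : 0 < ν) (hF : MemLp F 2 volume)
    (hu : IsGlobalLerayHopf ν (fun _ => F) u₀ u)
    (hU : ∀ t, 0 ≤ t → ((U t : (Lp (EuclideanSpace ℝ d) 2 (volume : Measure (UnitAddTorus d)))) : (UnitAddTorus d → EuclideanSpace ℝ d)) =ᵐ[volume] u t) {ψ : ℝ → ℝ} (hψc : Continuous ψ)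
    (hψ0 : ∀ x, 0 ≤ ψ x) {M : ℝ} (hψM : ∀ x, ψ x ≤ M) {T : ℝ} (hT : 0 < T) :
    ∫ x in (2 * FunctionSpaces.Torus.kineticEnergy u₀)..(∫ x, ‖u T x‖ ^ 2), ψ x ≤
      ∫ τ in (0 : ℝ)..T, ψ (∫ x, ‖u τ x‖ ^ 2) *
        (2 * ((∫ x, ⟪F x, u τ x⟫) - ν * (FunctionSpaces.Torus.eGradNormSq (u τ)).toReal)) := by
  classical
  -- the energy with `E 0 = |u₀|²`, and the flux `h`
  set E : ℝ → ℝ := fun t => if t = 0 then 2 * FunctionSpaces.Torus.kineticEnergy u₀ else ∫ x, ‖u t x‖ ^ 2 with hEdef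
  set h : ℝ → ℝ := fun τ => 2 * ((∫ x, ⟪F x, u τ x⟫) - ν * (FunctionSpaces.Torus.eGradNormSq (u τ)).toReal)
    with hhdef
  have hE0 : E 0 = 2 * FunctionSpaces.Torus.kineticEnergy u₀ := by simp [hEdef]
  have hEpos : ∀ t, 0 < t → E t = ∫ x, ‖u t x‖ ^ 2 := fun t ht => by simp [hEdef, ht.ne']
  have hh : IntegrableOn h (Ioc 0 T) :=
    ((hu.integrableOn_integral_inner_force hν hF hU hT).sub
      ((hu.integrableOn_toReal_eGradNormSq hT).1.const_mul ν)).const_mul 2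
  -- the good initial times
  set G : Set ℝ := {s | s = 0 ∨ (s ∈ Ioo 0 T ∧ ∀ t ∈ Icc s T,
    FunctionSpaces.Torus.kineticEnergy (u t) +
        ν * (∫⁻ τ in Ioo s t, FunctionSpaces.Torus.eGradNormSq (u τ)).toReal ≤
      FunctionSpaces.Torus.kineticEnergy (u s) + ∫ τ in s..t, ∫ x, ⟪F x, u τ x⟫)} with hGdef
  have hG0 : (0 : ℝ) ∈ G := Or.inl rfl
  have hGT : G ⊆ Icc 0 T := by
    rintro s (rfl | ⟨hs, -⟩)
    · exact ⟨le_rfl, hT.le⟩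
    · exact ⟨hs.1.le, hs.2.le⟩
  have hGae : ∀ᵐ s ∂volume, s ∈ Ioo 0 T → s ∈ G := by
    have h := (ae_restrict_iff' measurableSet_Ioo).1 (hu T hT).energy_ineq_ae
    filter_upwards [h] with s hs hmem
    exact Or.inr ⟨hmem, hs hmem⟩
  -- the restarted inequality
  have hrestart : ∀ s ∈ G, ∀ t ∈ Icc s T, E t - E s ≤ ∫ τ in s..t, h τ := by
    rintro s (rfl | ⟨hs, hsineq⟩) t ht
    · rcases eq_or_lt_of_le ht.1 with ht0 | ht0
      · subst ht0
        simp
      · rw [hEpos t ht0, hE0]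
        exact hu.energy_sub_le_integral hν hF hU le_rfl ht.1
          ((hu (t + 1) (by linarith)).energy_ineq_zero t ⟨ht.1, by linarith⟩)
    · rw [hEpos t (hs.1.trans_le ht.1), hEpos s hs.1]
      have hkin : 2 * FunctionSpaces.Torus.kineticEnergy (u s) = ∫ x, ‖u s x‖ ^ 2 := by
        rw [show FunctionSpaces.Torus.kineticEnergy (u s) = 2⁻¹ * ∫ x, ‖u s x‖ ^ 2 from rfl]
        ring
      rw [← hkin]
      exact hu.energy_sub_le_integral hν hF hU hs.1.le ht.1 (hsineq t ht)
  have hmain := intervalIntegral_le_integral_mul_of_restart hT hG0 hGT hGae hh hrestart hψc hψ0 hψM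
  rw [hE0, hEpos T hT] at hmain
  refine hmain.trans (le_of_eq (intervalIntegral.integral_congr_ae (ae_of_all _ fun τ hτ => ?_)))
  rw [uIoc_of_le hT.le] at hτ
  rw [hEpos τ hτ.1]

/-- **The dissipation side of the generalized energy inequality is bounded**:
`∫₀ᵀ ψ(|u|²) [ν‖∇u‖² - (F,u)] dt ≤ M · ½|u₀|²` for continuous `0 ≤ ψ ≤ M` and `T > 0`
(`∫_{|u₀|²}^{|u(T)|²} ψ ≥ -∫₀^{|u₀|²} ψ ≥ -M|u₀|²`; FMRT 2001, App. B.2, the step from the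
generalized energy inequality to (B.36)). [cite: FMRT2001, App. B.2 (B.35)–(B.36)] -/
theorem IsGlobalLerayHopf.integral_psi_dissipation_le (hν : 0 < ν) (hF : MemLp F 2 volume)
    (hu : IsGlobalLerayHopf ν (fun _ => F) u₀ u)
    (hU : ∀ t, 0 ≤ t → ((U t : (Lp (EuclideanSpace ℝ d) 2 (volume : Measure (UnitAddTorus d)))) : (UnitAddTorus d → EuclideanSpace ℝ d)) =ᵐ[volume] u t) {ψ : ℝ → ℝ} (hψc : Continuous ψ)
    (hψ0 : ∀ x, 0 ≤ ψ x) {M : ℝ} (hψM : ∀ x, ψ x ≤ M) {T : ℝ} (hT : 0 < T) :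
    ∫ τ in (0 : ℝ)..T, ψ (∫ x, ‖u τ x‖ ^ 2) *
        (ν * (FunctionSpaces.Torus.eGradNormSq (u τ)).toReal - ∫ x, ⟪F x, u τ x⟫) ≤
      M * FunctionSpaces.Torus.kineticEnergy u₀ := by
  set I : ℝ := ∫ τ in (0 : ℝ)..T, ψ (∫ x, ‖u τ x‖ ^ 2) *
    (ν * (FunctionSpaces.Torus.eGradNormSq (u τ)).toReal - ∫ x, ⟪F x, u τ x⟫) with hI
  set E₀ : ℝ := 2 * FunctionSpaces.Torus.kineticEnergy u₀ with hE₀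
  have hE₀0 : 0 ≤ E₀ := mul_nonneg zero_le_two (FunctionSpaces.Torus.kineticEnergy_nonneg _)
  have hmain := hu.intervalIntegral_psi_le hν hF hU hψc hψ0 hψM hT
  have hrhs : ∫ τ in (0 : ℝ)..T, ψ (∫ x, ‖u τ x‖ ^ 2) *
      (2 * ((∫ x, ⟪F x, u τ x⟫) - ν * (FunctionSpaces.Torus.eGradNormSq (u τ)).toReal)) = -2 * I := by
    rw [hI, ← intervalIntegral.integral_const_mul]
    exact integral_congr fun τ _ => by ring
  have hlhs : -(M * E₀) ≤ ∫ x in E₀..(∫ x, ‖u T x‖ ^ 2), ψ x := by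
    rw [← integral_interval_sub_left (a := (0 : ℝ)) (hψc.intervalIntegrable _ _) (hψc.intervalIntegrable _ _)]
    have h1 : 0 ≤ ∫ x in (0 : ℝ)..(∫ x, ‖u T x‖ ^ 2), ψ x :=
      intervalIntegral.integral_nonneg (integral_nonneg fun x => sq_nonneg _) fun x _ => hψ0 x
    have h2 : ∫ x in (0 : ℝ)..E₀, ψ x ≤ M * E₀ := by
      have h := intervalIntegral.norm_integral_le_of_norm_le_const (a := (0 : ℝ)) (b := E₀) (f := ψ)
        (C := M) fun x _ => by rw [Real.norm_eq_abs, abs_of_nonneg (hψ0 x)]; exact hψM x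
      rw [sub_zero, abs_of_nonneg hE₀0, Real.norm_eq_abs] at h
      exact (le_abs_self _).trans h
    linarith
  rw [hrhs] at hmain
  have hfin : M * E₀ / 2 = M * FunctionSpaces.Torus.kineticEnergy u₀ := by
    rw [hE₀]
    ring
  linarith

/-- **(B.36) in Cesàro form**: `T⁻¹ ∫₀ᵀ ψ(|u|²) [ν‖∇u‖² - (F,u)] dt ≤ (M · ½|u₀|²) T⁻¹` for `T > 0`
(FMRT 2001, App. B.2 (B.36): `liminf T⁻¹ ∫₀ᵀ 2[(f,u) - ν‖u‖²] ρ'(|u|²) ≥ 0`). [cite: FMRT2001, App. B.2 (B.36)] -/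
theorem IsGlobalLerayHopf.timeMean_psi_dissipation_le (hν : 0 < ν) (hF : MemLp F 2 volume)
    (hu : IsGlobalLerayHopf ν (fun _ => F) u₀ u)
    (hU : ∀ t, 0 ≤ t → ((U t : (Lp (EuclideanSpace ℝ d) 2 (volume : Measure (UnitAddTorus d)))) : (UnitAddTorus d → EuclideanSpace ℝ d)) =ᵐ[volume] u t) {ψ : ℝ → ℝ} (hψc : Continuous ψ)
    (hψ0 : ∀ x, 0 ≤ ψ x) {M : ℝ} (hψM : ∀ x, ψ x ≤ M) {T : ℝ} (hT : 0 < T) :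
    timeMean (fun τ => ψ (∫ x, ‖u τ x‖ ^ 2) *
        (ν * (FunctionSpaces.Torus.eGradNormSq (u τ)).toReal - ∫ x, ⟪F x, u τ x⟫)) T ≤
      M * FunctionSpaces.Torus.kineticEnergy u₀ * T⁻¹ := by
  unfold timeMean
  rw [mul_comm]
  exact mul_le_mul_of_nonneg_right (hu.integral_psi_dissipation_le hν hF hU hψc hψ0 hψM hT)
    (inv_nonneg.2 hT.le)

end Literature.Analysis.FluidPDE.Torus
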